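import Literature.NumberTheory.Weil1964.AdelicDoublingDeltaOriginValue
import Literature.NumberTheory.GelbartRogawski1991.DoubledWeilRepresentationUndoublingGen
import Literature.NumberTheory.Weil1964.AdelicSchrodingerConj
import HarnessLib

/-!
# Li's section value along the block-diagonal doubling embedding: `f_{δ(φ₁⊗φ̄₂)}(i(g,1)) = ⟨ω(s g)φ₁, φ₂⟩`
# (E-2 ∕ Rallis inner product, move R4 «section value», the `g`-EQUIVARIANT form of the value at the origin)

Topic `NumberTheory/Weil1964`; namespace `Literature.NumberTheory.Weil1964`.  KERNEL MATHEMATICS ONLY (theorems over existing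
tree declarations; no `def`, no named fact, no `sorry`).  Cell hodgecm-mathlib FLOOR 0, programme E-2 (director s393, F0P4-plan (g3)
brief «R4-prep» 2026-08-30T23:42Z); author A-p12 (g12).

★ `AdelicDoublingDeltaOriginValue` proves Li's identity at the IDENTITY of the doubled group ([Li1992, (13) p. 181–182]): for Weil's
lift `r_F(δ)` of the rational element `δ` on the doubled space `Fin (n + n)` (Gram matrix `S = (T ⊕ −T)` renumbered by
`e₂ = finSumFinEquiv`) and the box vector `R_{e₂}(φ₁ ⊠ φ̄₂)`, `ν(D^n) · (ω(r_F δ)(R_{e₂}(φ₁ ⊠ φ̄₂)))(0) = ∫ φ₁ φ̄₂ dν`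
(`= ⟨φ₁, φ₂⟩` for the Tamagawa-normalised `ν`).  The Siegel–Weil section of [Li1992, (25)] ∕ [HarrisKudlaSweet1996, (1.5)] is this
value AFTER the doubled Weil representation has acted: `f_{δ(φ₁⊗φ̄₂)}(h□) = (ω(r_F δ)(ω□(h□)(φ₁ ⊠ φ̄₂)))(0)`.  Along the block-diagonal
embedding `i(g, 1) = ι(g) ⊕ 1` of `U(V)(𝔸) × U(W)(𝔸)` into the doubled unitary group, the doubled splitting `sD` acts on pure tensors
through the UNDOUBLED splitting `s(g) = undouble sD g` of [GelbartRogawski1991, §3.1 Prop. 3.1.1] ∕ [Kudla1994, §2]: ★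
`GRConstructionGen.omega_uD_tensorToSum` — `ω(u(g))(Φ₁ ⊠ Φ₂) = ω(s(g))Φ₁ ⊠ Φ₂` for `u(g) = undoubleIdx (sD (g ⊕ 1))`, the doubled
operator read on `Fin n ⊕ Fin n` (Gram `Tg ⊕ (−Tg)`).  THIS FILE composes the two:

* `measure_mul_omega_ratThetaLiftCont_doublingDeltaRat_omega_uD_boxConj_apply_zero` — for every `g` in the adelic pair group and all
  `φ₁ φ₂ ∈ 𝒮(𝔸^n)`: **`ν(D^n) · (ω(r_F δ)(R_{e₂}(ω(u(g))(φ₁ ⊠ φ̄₂))))(0) = ∫ (ω(s(g))φ₁) · φ̄₂ dν`** — Li's (25) read on the undoubled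
  side (`S` any matrix propositionally equal to `(T_𝕎 ⊗ 1) ⊕ −(T_𝕎 ⊗ 1)` renumbered, hypothesis `hS`, as in the origin file);
* `omega_ratThetaLiftCont_doublingDeltaRat_omega_uD_boxConj_apply_zero` — the Tamagawa-normalised form (`ν(D^n) = 1`):
  `(ω(r_F δ)(R_{e₂}(ω(u(g))(φ₁ ⊠ φ̄₂))))(0) = ∫ (ω(s(g))φ₁) · φ̄₂ dν = ⟨ω(s(g))φ₁, φ₂⟩_{L²(ν)}`.

What is NOT here (left to the E-2 R4 hand once the letter `stub_E2R4_sectionValue` is typed): the renumbering of the doubled operator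
back to `Fin (n + n)` (`R_{e₂}(ω(u(g))Ψ) = ω(sD (g ⊕ 1))(R_{e₂}Ψ)`, the `C = 1` relabel + `e₂⁻¹` reindex inside `undoubleIdx`), the Siegel
base point `p₀`, and the identification of `s(g)` with the splitting of record (★ `S4_undouble` ∕ `CompatibleSplitting`).

HC_CM is proved only modulo the 7 printed citations until rung 0 closes; this is a generic Literature brick for E-2 (R4), nothing of
[Liu2021] is discharged here.

## References
* [Li1992] J.-S. Li, *Non-vanishing theorems for the cohomology of certain arithmetic quotients*, J. reine angew. Math. 428 (1992),
  (13) pp. 181–182 and (25) p. 186.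
* [HarrisKudlaSweet1996] M. Harris, S. Kudla, W. Sweet, *Theta dichotomy for unitary groups*, J. AMS 9 (1996), §1 (1.5), (1.16).
* [GelbartRogawski1991] S. Gelbart, J. Rogawski, Invent. Math. 105 (1991), §3.1 Prop. 3.1.1 p. 455; [Kudla1994] S. Kudla, Israel J. Math.
  87 (1994), §2, Thm. 3.1.
* Tree: ★ `Weil1964/AdelicDoublingDeltaOriginValue` (`measure_mul_omega_ratThetaLiftCont_doublingDeltaRat_boxConj_apply_zero`),
  ★ `GelbartRogawski1991/DoubledWeilRepresentationUndoublingGen` (`uD`, `undouble`, `omega_uD_tensorToSum`, `gramA_eq_map`, `isUnit_gram`).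
-/

set_option autoImplicit false

noncomputable section

open scoped Matrix ComplexConjugate

namespace Literature.NumberTheory.Weil1964

open NumberField IsDedekindDomain _root_.MeasureTheory _root_.MeasureTheory.Measure
open Literature.NumberTheory.Automorphic Literature.RepresentationTheory.HeisenbergGroup
open Literature.NumberTheory.GelbartRogawski1991 Literature.NumberTheory.GelbartRogawski1991.UnitaryDualPair
open Literature.NumberTheory.GelbartRogawski1991.GRConstructionGen

variable (F : Type) [Field F] [NumberField F] (E : Type) [Field E] [NumberField E] [Algebra F E]
  [Algebra.IsQuadraticExtension F E]
variable (c : E ≃ₐ[F] E) {δ : E} (hcδ : c δ = -δ) (hδ : δ ≠ 0) {d : F} (hd : δ * δ = algebraMap F E d)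
variable {N M n : ℕ} (e : Fin N × Fin M ≃ Fin n)
  (TV : Matrix (Fin N) (Fin N) F) (hV : TV.IsSymm) (hVd : IsUnit TV.det)
  (TW : Matrix (Fin M) (Fin M) F) (hW : TW.IsSymm) (hWd : IsUnit TW.det)
variable {sD : HA F E c e TV TW →* MpD F e TV TW}
variable [MeasurableSpace (AdeleRing (𝓞 F) F)] [BorelSpace (AdeleRing (𝓞 F) F)]
  (ν : Measure (Fin n → AdeleRing (𝓞 F) F)) [ν.IsAddHaarMeasure]

/-- **Li's section value along `i(g,1)`, undoubled side, any additive Haar measure**: for every `g` in the adelic pair group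
`U(V)(𝔸) × U(W)(𝔸)`, `ν(D^n) · (ω(r_F δ)(R_{e₂}(ω(u(g))(φ₁ ⊠ φ̄₂))))(0) = ∫_{𝔸^n} (ω(s(g))φ₁)(u) · conj (φ₂ u) dν(u)`, where
`u(g) = undoubleIdx (sD (g ⊕ 1))` is the doubled splitting on `g ⊕ 1` read on `Fin n ⊕ Fin n` and `s(g) = undouble sD g` the undoubled splitting
(★ product formula `omega_uD_tensorToSum`), `r_F(δ)` Weil's lift of `δ` on the doubled space with Gram matrix `S = (T_𝕎 ⊗ 1) ⊕ −(T_𝕎 ⊗ 1)`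
renumbered by `e₂` (hypothesis `hS`). [cite: Li1992, (13) pp. 181–182 and (25) p. 186] [cite: HarrisKudlaSweet1996, §1 (1.5)]
[cite: GelbartRogawski1991, §3.1 Prop. 3.1.1 p. 455] -/
theorem measure_mul_omega_ratThetaLiftCont_doublingDeltaRat_omega_uD_boxConj_apply_zero
    (hproj : ∀ h, projD F e TV TW (sD h) = toSpD F E c hcδ hδ hd e TV hV TW hW h)
    {S : Matrix (Fin (n + n)) (Fin (n + n)) (AdeleRing (𝓞 F) F)}
    (hS : S = doubledGramFin F ((gramR F e TV TW).map (algebraMap F (AdeleRing (𝓞 F) F)))) (hSd : IsUnit S.det)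
    (g : UnitaryGroup.adelicPair F E c N M (TV.map (algebraMap F E)) (TW.map (algebraMap F E)))
    (φ₁ φ₂ : piSchwartzBruhat F (Fin n)) :
    ((ν (piFundamentalDomain F (Fin n))).toReal : ℂ) *
        ((adelicMpCont.omega F (Fin (n + n)) S (ratThetaLiftCont F S hSd (doublingDeltaRat F))
          (piSBReindex F finSumFinEquiv
            (adelicMpCont.omega F (Fin n ⊕ Fin n) (gramS F e TV TW) (uD F E c e TV TW sD g)
              (tensorToSum F (Fin n) (Fin n) φ₁ (piSchwartzBruhatConj F (Fin n) φ₂)))) :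
          piSchwartzBruhat F (Fin (n + n))) : (Fin (n + n) → (AdeleRing (𝓞 F) F)) → ℂ) 0 =
      ∫ u,
        ((adelicMpCont.omega F (Fin n) (gramA F e TV TW) (undouble F E c hcδ hδ hd e TV hV hVd TW hW hWd hproj g) φ₁ :
            piSchwartzBruhat F (Fin n)) : (Fin n → (AdeleRing (𝓞 F) F)) → ℂ) u *
          conj ((φ₂ : (Fin n → (AdeleRing (𝓞 F) F)) → ℂ) u) ∂ν :=
  (congrArg (fun Ψ : piSchwartzBruhat F (Fin n ⊕ Fin n) =>
      ((ν (piFundamentalDomain F (Fin n))).toReal : ℂ) *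
        ((adelicMpCont.omega F (Fin (n + n)) S (ratThetaLiftCont F S hSd (doublingDeltaRat F)) (piSBReindex F finSumFinEquiv Ψ) :
          piSchwartzBruhat F (Fin (n + n))) : (Fin (n + n) → (AdeleRing (𝓞 F) F)) → ℂ) 0)
    (omega_uD_tensorToSum F E c hcδ hδ hd e TV hV hVd TW hW hWd hproj g φ₁ (piSchwartzBruhatConj F (Fin n) φ₂))).trans
    (measure_mul_omega_ratThetaLiftCont_doublingDeltaRat_boxConj_apply_zero F ν (gramR F e TV TW)
      ((Matrix.isUnit_iff_isUnit_det _).2 (isUnit_det_gram F e hVd hWd)) hS hSd _ φ₂)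

/-- scalar bookkeeping on atoms: `m · A = I`, `m = 1` ⇒ `A = I`. [folklore] -/
private theorem eq_of_one_mul_eq {m A I : ℂ} (h : m * A = I) (hm : m = 1) : A = I := by
  rw [hm, one_mul] at h
  exact h

/-- **Li's (25) along `i(g,1)`, Tamagawa normalisation** (`ν(D^n) = 1`): `(ω(r_F δ)(R_{e₂}(ω(u(g))(φ₁ ⊠ φ̄₂))))(0) =
∫ (ω(s(g))φ₁) · φ̄₂ dν = ⟨ω(s(g))φ₁, φ₂⟩_{L²(ν)}`. [cite: Li1992, (25) p. 186] [cite: HarrisKudlaSweet1996, §1 (1.5) and (1.16) p. 952] -/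
theorem omega_ratThetaLiftCont_doublingDeltaRat_omega_uD_boxConj_apply_zero
    (hproj : ∀ h, projD F e TV TW (sD h) = toSpD F E c hcδ hδ hd e TV hV TW hW h)
    {S : Matrix (Fin (n + n)) (Fin (n + n)) (AdeleRing (𝓞 F) F)}
    (hS : S = doubledGramFin F ((gramR F e TV TW).map (algebraMap F (AdeleRing (𝓞 F) F)))) (hSd : IsUnit S.det)
    (hν : ν (piFundamentalDomain F (Fin n)) = 1)
    (g : UnitaryGroup.adelicPair F E c N M (TV.map (algebraMap F E)) (TW.map (algebraMap F E)))
    (φ₁ φ₂ : piSchwartzBruhat F (Fin n)) :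
    ((adelicMpCont.omega F (Fin (n + n)) S (ratThetaLiftCont F S hSd (doublingDeltaRat F))
          (piSBReindex F finSumFinEquiv
            (adelicMpCont.omega F (Fin n ⊕ Fin n) (gramS F e TV TW) (uD F E c e TV TW sD g)
              (tensorToSum F (Fin n) (Fin n) φ₁ (piSchwartzBruhatConj F (Fin n) φ₂)))) :
          piSchwartzBruhat F (Fin (n + n))) : (Fin (n + n) → (AdeleRing (𝓞 F) F)) → ℂ) 0 =
      ∫ u,
        ((adelicMpCont.omega F (Fin n) (gramA F e TV TW) (undouble F E c hcδ hδ hd e TV hV hVd TW hW hWd hproj g) φ₁ :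
            piSchwartzBruhat F (Fin n)) : (Fin n → (AdeleRing (𝓞 F) F)) → ℂ) u *
          conj ((φ₂ : (Fin n → (AdeleRing (𝓞 F) F)) → ℂ) u) ∂ν :=
  eq_of_one_mul_eq
    (measure_mul_omega_ratThetaLiftCont_doublingDeltaRat_omega_uD_boxConj_apply_zero F E c hcδ hδ hd e TV hV hVd TW hW hWd ν
      hproj hS hSd g φ₁ φ₂)
    (by rw [hν, ENNReal.toReal_one, Complex.ofReal_one])

omit [MeasurableSpace (AdeleRing (𝓞 F) F)] [BorelSpace (AdeleRing (𝓞 F) F)] in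
/-- **The doubled Gram matrix of record IS of the shape `hS`**: `T^𝔻 ⊗ 1 = ((T_𝕎 ⊗ 1) ⊕ −(T_𝕎 ⊗ 1))` renumbered by `e₂` — so both theorems
apply with `S := gramDA F e TV TW` (the Gram matrix indexing `MpD`, the home of the doubled splitting `sD`).
[cite: GelbartRogawski1991, §3.1 Prop. 3.1.1 p. 455] -/
theorem gramDA_eq_doubledGramFin :
    gramDA F e TV TW = doubledGramFin F ((gramR F e TV TW).map (algebraMap F (AdeleRing (𝓞 F) F))) := by
  rw [gramDA, gramD, doubledGramFin_eq, Matrix.reindex_apply, Matrix.reindex_apply, ← Matrix.submatrix_map,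
    Matrix.fromBlocks_map, Matrix.map_zero _ (map_zero _), Matrix.map_neg _ (fun a => map_neg _ a)]

end Literature.NumberTheory.Weil1964

end
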